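import Mathlib
import Summits.Ventures.HodgeRepro2.T5ResidueFieldFinite
import Summits.Ventures.HodgeRepro2.T5StarOfInvolution
import Summits.Ventures.HodgeRepro2.T5QuadraticTrace

/-!
# The trace `𝒪_E → 𝒪_F` of an unramified extension is onto: `∃ x ∈ 𝒪_E`, `x + σ x = 1`

Blind cell `pub-hodge-repro2`, seat p8 (gen 13), Tier-5 kernel support.  The integral normal form
`T5HermitianIsotropicLattice` takes, for the hyperbolic partner, a TRACE DECOMPOSITION: every
star-fixed integral `y` is `c + star c` with `c` integral (trivial when `2 ∈ R^×`).  At the record's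
inert places `star` is the Galois conjugation `σ` of the unramified quadratic `E_v / F_v`, and the
decomposition holds at ALL residue characteristics because the trace `𝒪_{E_v} → 𝒪_{F_v}` is onto
(Serre, Local Fields, III §5) — this file puts that in kernel for `R₀` a DVR with finite residue
field, `E / F` finite separable with `𝒪_E = integralClosure R₀ E` local and `𝔭 𝒪_E = 𝔭_E`:

* `module_free_integralClosure` — `𝒪_E` is a free `R₀`-module (finite torsion-free over a PID);
* `exists_trace_eq_one` — **the trace `𝒪_E → R₀` takes the value `1`**: Mathlib's
  `Algebra.trace_quotient_mk` reduces the trace modulo `𝔭` to the trace of the residue extension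
  `𝒪_E / 𝔭 𝒪_E = 𝒪_E / 𝔭_E` over `R₀ / 𝔭`, which is onto (finite fields are perfect), so the image
  ideal of the trace is not inside `𝔭`, hence is `R₀` (`R₀` local);
* `isGalois_of_finrank_eq_two` — for `[E : F] = 2` and `σ ≠ 1`, `E / F` is Galois
  (`Gal(E/F) ⊇ {1, σ}` has `2 = [E : F]` elements), so `T5QuadraticTrace`'s
  `algebraMap_trace_eq_add_apply` applies: `Tr_{E/F}(x) = x + σ x`;
* `exists_isInteger_add_apply_eq_one` — **`∃ x ∈ 𝒪_E` with `x + σ x = 1`** (the trace of `𝒪_E`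
  over `R₀` agrees with `Tr_{E/F}`: `Algebra.algebraMap_intTrace`, `Algebra.intTrace_eq_trace`);
* `trace_decomposition_of_add_star_eq_one` — from one such `x`, `c = y x` decomposes every
  star-fixed integral `y` (`c + star c = y (x + star x) = y`);
* `trace_decomposition_of_unramified` — **the hypothesis `htr` of
  `T5HermitianIsotropicLattice.exists_congruent_J3_integral_of_trace` for the Galois star
  `starRingOfQuadratic` at an unramified place** — the dyadic inert places included.

README §8(d): uses an L-value-free non-vanishing device: NO.
-/

namespace Summit.Ventures.HodgeRepro2.T5UnramifiedTraceOne

open IsLocalRing IsLocalization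

section Trace

variable (R₀ F E : Type*) [CommRing R₀] [IsDomain R₀] [IsDiscreteValuationRing R₀] [Field F]
  [Field E] [Algebra R₀ F] [IsFractionRing R₀ F] [Algebra F E] [Algebra R₀ E]
  [IsScalarTower R₀ F E] [FiniteDimensional F E] [Algebra.IsSeparable F E]

omit [IsDomain R₀] [IsDiscreteValuationRing R₀] [FiniteDimensional F E]
  [Algebra.IsSeparable F E] in
include F in
/-- The structure map `R₀ → 𝒪_E` is injective. -/
theorem algebraMap_integralClosure_injective :
    Function.Injective (algebraMap R₀ (integralClosure R₀ E)) := by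
  have h : algebraMap R₀ E = (algebraMap (integralClosure R₀ E) E).comp
      (algebraMap R₀ (integralClosure R₀ E)) := IsScalarTower.algebraMap_eq _ _ _
  have hinj := T5UnramifiedUniformiser.algebraMap_injective R₀ F E
  rw [h, RingHom.coe_comp] at hinj
  exact hinj.of_comp

omit [IsDiscreteValuationRing R₀] [FiniteDimensional F E] [Algebra.IsSeparable F E] in
include F in
/-- `𝒪_E` is a torsion-free `R₀`-module. -/
theorem isTorsionFree_integralClosure : Module.IsTorsionFree R₀ (integralClosure R₀ E) := by
  rw [Module.isTorsionFree_iff_algebraMap_injective]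
  exact algebraMap_integralClosure_injective R₀ F E

include F in
/-- **`𝒪_E` is a free `R₀`-module**: finite and torsion-free over the PID `R₀`. -/
theorem module_free_integralClosure : Module.Free R₀ (integralClosure R₀ E) := by
  haveI := T5ResidueFieldFinite.module_finite_integralClosure R₀ F E
  haveI := isTorsionFree_integralClosure R₀ F E
  exact Module.free_of_finite_type_torsion_free'

include F in
/-- **The trace `𝒪_E → R₀` takes the value `1`** when `𝔭 𝒪_E = 𝔭_E` and the residue field of
`R₀` is finite: modulo `𝔭` the trace is the trace of the residue field extension, which is onto
(a finite extension of a finite field is separable), so the image ideal of the trace is not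
contained in the maximal ideal of the local ring `R₀`, hence is the whole of `R₀`. -/
theorem exists_trace_eq_one [IsLocalRing (integralClosure R₀ E)] [Finite (ResidueField R₀)]
    (hunr : (maximalIdeal R₀).map (algebraMap R₀ (integralClosure R₀ E)) =
      maximalIdeal (integralClosure R₀ E)) :
    ∃ x : integralClosure R₀ E, Algebra.trace R₀ (integralClosure R₀ E) x = 1 := by
  haveI := T5ResidueFieldFinite.module_finite_integralClosure R₀ F E
  haveI := module_free_integralClosure R₀ F E
  haveI hmax : ((maximalIdeal R₀).map (algebraMap R₀ (integralClosure R₀ E))).IsMaximal := by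
    rw [hunr]
    exact maximalIdeal.isMaximal _
  letI : Field (R₀ ⧸ maximalIdeal R₀) := Ideal.Quotient.field _
  letI : Field (integralClosure R₀ E ⧸
      (maximalIdeal R₀).map (algebraMap R₀ (integralClosure R₀ E))) := Ideal.Quotient.field _
  haveI : Module.Finite (R₀ ⧸ maximalIdeal R₀) (integralClosure R₀ E ⧸
      (maximalIdeal R₀).map (algebraMap R₀ (integralClosure R₀ E))) :=
    Module.Finite.of_restrictScalars_finite R₀ _ _
  haveI : Finite (R₀ ⧸ maximalIdeal R₀) := ‹Finite (ResidueField R₀)›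
  obtain ⟨y, hy⟩ := Algebra.trace_surjective (R₀ ⧸ maximalIdeal R₀) (integralClosure R₀ E ⧸
    (maximalIdeal R₀).map (algebraMap R₀ (integralClosure R₀ E))) 1
  obtain ⟨x, rfl⟩ := Ideal.Quotient.mk_surjective y
  rw [Algebra.trace_quotient_mk] at hy
  have hI : LinearMap.range (Algebra.trace R₀ (integralClosure R₀ E)) = ⊤ := by
    by_contra hne
    have hmem : Algebra.trace R₀ (integralClosure R₀ E) x ∈ maximalIdeal R₀ :=
      IsLocalRing.le_maximalIdeal hne (LinearMap.mem_range_self _ x)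
    rw [← Ideal.Quotient.eq_zero_iff_mem] at hmem
    rw [hmem] at hy
    exact zero_ne_one hy
  exact (LinearMap.range_eq_top.mp hI) 1

end Trace

section Quadratic

variable {F E : Type*} [Field F] [Field E] [Algebra F E] [FiniteDimensional F E]

/-- A degree-`2` extension with a non-trivial automorphism is Galois (`Gal(E/F) = {1, σ}` has
`2 = [E : F]` elements). -/
theorem isGalois_of_finrank_eq_two (h2 : Module.finrank F E = 2) (σ : E ≃ₐ[F] E) (hσ : σ ≠ 1) :
    IsGalois F E := by
  apply IsGalois.of_card_aut_eq_finrank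
  rw [Nat.card_eq_fintype_card, h2]
  apply le_antisymm
  · exact h2 ▸ AlgEquiv.card_le
  · haveI : Nontrivial (E ≃ₐ[F] E) := ⟨⟨σ, 1, hσ⟩⟩
    exact Fintype.one_lt_card

end Quadratic

section Bridge

variable {R E : Type*} [CommRing R] [CommRing E] [StarRing E] [Algebra R E]

/-- From ONE integral `x` with `x + star x = 1`, every star-fixed integral `y` is `c + star c`
with `c = y x` integral. -/
theorem trace_decomposition_of_add_star_eq_one {x : E} (hx : IsInteger R x)
    (hxx : x + star x = 1) :
    ∀ y : E, IsInteger R y → star y = y → ∃ c : E, IsInteger R c ∧ c + star c = y := by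
  intro y hy hsy
  refine ⟨y * x, isInteger_mul hy hx, ?_⟩
  rw [star_mul', hsy, ← mul_add, hxx, mul_one]

end Bridge

section Main

variable (R₀ F E : Type*) [CommRing R₀] [IsDomain R₀] [IsDiscreteValuationRing R₀] [Field F]
  [Field E] [Algebra R₀ F] [IsFractionRing R₀ F] [Algebra F E] [Algebra R₀ E]
  [IsScalarTower R₀ F E] [FiniteDimensional F E] [Algebra.IsSeparable F E]
  [IsLocalRing (integralClosure R₀ E)] [Finite (ResidueField R₀)]

include F in
/-- **`∃ x ∈ 𝒪_E` with `x + σ x = 1`** for `E / F` quadratic with `σ ≠ 1` and `𝔭 𝒪_E = 𝔭_E`: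
the `x` with `Tr_{𝒪_E / R₀}(x) = 1`, since the trace of `𝒪_E` over `R₀` is `Tr_{E/F}` on `𝒪_E`
and `Tr_{E/F} = 1 + σ`. -/
theorem exists_isInteger_add_apply_eq_one (h2 : Module.finrank F E = 2) (σ : E ≃ₐ[F] E)
    (hσ : σ ≠ 1)
    (hunr : (maximalIdeal R₀).map (algebraMap R₀ (integralClosure R₀ E)) =
      maximalIdeal (integralClosure R₀ E)) :
    ∃ x : E, IsInteger (integralClosure R₀ E) x ∧ x + σ x = 1 := by
  obtain ⟨x₀, hx₀⟩ := exists_trace_eq_one R₀ F E hunr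
  refine ⟨algebraMap (integralClosure R₀ E) E x₀, ⟨x₀, rfl⟩, ?_⟩
  haveI := T5ResidueFieldFinite.module_finite_integralClosure R₀ F E
  haveI := module_free_integralClosure R₀ F E
  haveI := isTorsionFree_integralClosure R₀ F E
  haveI : IsIntegrallyClosed (integralClosure R₀ E) :=
    integralClosure.isIntegrallyClosedOfFiniteExtension F
  have htr : Algebra.trace F E (algebraMap (integralClosure R₀ E) E x₀) = 1 := by
    rw [← Algebra.algebraMap_intTrace (A := R₀) (K := F), Algebra.intTrace_eq_trace, hx₀, map_one]
  haveI := isGalois_of_finrank_eq_two h2 σ hσ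
  rw [← T5QuadraticTrace.algebraMap_trace_eq_add_apply h2 σ hσ, htr, map_one]

include F in
/-- **The trace decomposition at an unramified place, all residue characteristics**: for the
Galois star `starRingOfQuadratic h2 σ hσ`, every star-fixed integral `y ∈ E` is `c + star c` with
`c` integral — the hypothesis `htr` of `T5HermitianIsotropicLattice` (T5-137b). -/
theorem trace_decomposition_of_unramified (h2 : Module.finrank F E = 2) (σ : E ≃ₐ[F] E)
    (hσ : σ ≠ 1)
    (hunr : (maximalIdeal R₀).map (algebraMap R₀ (integralClosure R₀ E)) =
      maximalIdeal (integralClosure R₀ E)) :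
    letI := T5StarOfInvolution.starRingOfQuadratic h2 σ hσ
    ∀ y : E, IsInteger (integralClosure R₀ E) y → star y = y →
      ∃ c : E, IsInteger (integralClosure R₀ E) c ∧ c + star c = y := by
  letI := T5StarOfInvolution.starRingOfQuadratic h2 σ hσ
  obtain ⟨x, hx, hxx⟩ := exists_isInteger_add_apply_eq_one R₀ F E h2 σ hσ hunr
  exact trace_decomposition_of_add_star_eq_one hx hxx

end Main

end Summit.Ventures.HodgeRepro2.T5UnramifiedTraceOne
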